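/-
Copyright (c) 2026 the pub-hodgecm-mathlib formalisation cell (harness21).  Prover seat hodgecm-mathlib-K2E2-p12 (g6): Track B «K2-LIT», ENGINE E1,
h413 = stmt-HodgeConjecture-24833; line `K2_E1_TraceFormulaBeta`, 5Res campaign «ENDGAME BY FAMILIES», ROADCARD §3′ (M2 v2, amendment #2), deal (241) of K2E1-plan (g7):
THE E1 ALGEBRA-LETTER PLUG for ★ D5′ `K2E1IrreducibleNoContinuousSpectrumU` (p860349) — `hnd`, `hAW` and the block-projector letters `hPV hPid hPsa hPW hVc` at `cmDatum L N H`.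
-/
import Summits.HodgeConjecture.HodgeConjecture.Theorems.K2E1KTypeProjectorPureTensorU   -- ★ p860372 (+ ★ p860333 `K2E1PureTensorHeckeAlgebraU`, ★ `IntegratedOperatorStar`, ★ `IntegratedOperatorDiracSequence`)
import Literature.NumberTheory.Automorphic.UnitaryGroupAdelicProductHaar              -- ★ `t2Space_finAdelic`, `locallyCompactSpace_finAdelic`, `secondCountableTopology_finAdelic`
import HarnessLib

/-!
# K2·E1 — `K2E1HeckeAlgebraLettersCM` (deal (241)): THE E1 LETTERS OF ★ D5′ p860349 — NON-DEGENERACY `hnd`, SUBREPRESENTATION STABILITY `hAW`, AND THE BLOCK PROJECTOR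
# `P = P_χ ∘ R_f(e)` WITH ITS LETTERS `hPV hPid hPsa hPW hVc` — AT `U(H)(𝔸_{L⁺}) = U(H)(L⁺ ⊗ ℝ) · U(H)(𝔸_{L⁺,f})` (★ `cmDatum L N H`, every `N`, every `H`)

Track B ∕ K2-LIT, crux h413 = `stmt-HodgeConjecture-24833`, route of record `HCCMUnconditional`; cell `hodgecm-mathlib`, squad K2, ENGINE E1 (5Res campaign, M2 v2 §3′.1, D5′ proper
★ p860349 `indicator_lpSMul_proj_eq_zero_of_irreducible_subrep` of K2E4-p23).  THEOREMS ONLY (no `def`, no `instance`, no notation, no named-fact hypothesis, no `sorry`; default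
heartbeats); lane `--supports stmt-HodgeConjecture-24833 --as helper` (count-neutral).  CLOSES NO SOCKET.

THE LETTERS OF ★ p860349 AND WHERE THEY ARE PAID (operator family `𝓐 = {π_∞(a) ∘L π_f(b)}` of ★ p860333):
* `h𝓐` (A1), `hstar` (A3): ALREADY ★ p860333 §2 `cm_comp_pureTensor_mem`, `cm_adjoint_pureTensor_mem` (verbatim binder shapes; not restated here).
* `hnd` (A2): §3 **`cm_pureTensor_nondegenerate`** — the INSTANCE edition at `cmDatum L N H` (Dirac sequences exist on `U(H)(L⁺ ⊗ ℝ)` and `U(H)(𝔸_{L⁺,f})`: ★ `exists_isDiracSequence` with ★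
  `instT2SpaceArch`∕`instLocallyCompactSpaceArch`∕`instSecondCountableTopologyArch` and ★ `t2Space_finAdelic`∕`locallyCompactSpace_finAdelic`∕`secondCountableTopology_finAdelic`; measures
  positive on opens).
* `hAW`: §2 **`pureTensor_apply_mem`** (generic) ∕ §3 **`cm_pureTensor_apply_mem`** — every `R₁ a ∘L R₂ b` preserves every closed `π`-stable `W` (★ `integratedOperator_apply_mem` for the
  restricted representations, whose closed subrepresentations include those of `π`).
* the block projector `P := P_χ ∘L R₂ e` (`P_χ = ∫_K χ(k) π(ι₁ κ k) dμ` the `K`-type projector of ★ p860372, `R₂ e` the level idempotent of ★ p860372) with `V := eqLocus P id = {v | P v = v}`: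
  §1 (generic Hilbert-space algebra) `comp_idem_of_commute`, `adjoint_comp_of_commute`, `mem_eqLocus_of_idem` (hPV), `apply_eq_of_mem_eqLocus` (hPid), `inner_left_eq_of_adjoint_eq` (hPsa),
  `isClosed_eqLocus_id` (hVc); §2 (two-factor generic) **`blockProjector_idem`**, **`blockProjector_adjoint`**, **`blockProjector_apply_mem`** (hPW); §3 the `cmDatum` prints
  **`cm_blockProjector_hPV ∕ _hPsa ∕ _hPW`**.
HONEST LABEL: HC_CM is proved only modulo the 7 printed citations (2 remaining named inputs: hLiu418 = `stmt-HodgeConjecture-24832`, h413 = `stmt-HodgeConjecture-24833`) until rung 0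
closes; this file asserts no named fact and closes no socket; count-neutral; unconditional.

## References
* [DeitmarEchterhoff2014] A. Deitmar, S. Echterhoff, *Principles of Harmonic Analysis* (2nd ed., 2014): Prop. 6.2.1, Lemma 6.2.2, §7.4, §9.2.
* [Knapp1986] A. W. Knapp, *Representation Theory of Semisimple Groups* (1986): VIII §3.
* [BorelJacquet1979] A. Borel, H. Jacquet, PSPM 33.1 (1979): §4.1.
* [MoeglinWaldspurger1995] C. Mœglin, J.-L. Waldspurger (1995): IV.3.12, VI.2.
-/

set_option autoImplicit false
set_option linter.dupNamespace false -- the mandated namespace repeats `HodgeConjecture.HodgeConjecture`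

noncomputable section

open MeasureTheory Filter Topology CompactlySupported NumberField ContRepresentation
open Literature.NumberTheory.Automorphic Literature.NumberTheory.Automorphic.UnitaryGroup AdelicGroupData
open Summit.HodgeConjecture.HodgeConjecture.Cruxes.H413.K2E1PureTensorHeckeAlgebraU (eq_zero_of_forall_pureTensor_apply_eq_zero)
open Summit.HodgeConjecture.HodgeConjecture.Cruxes.H413.K2E1KTypeProjectorPureTensorU (kType_comm_integratedOperator)
open scoped InnerProductSpace ComplexConjugate

namespace Summit.HodgeConjecture.HodgeConjecture.Cruxes.H413.K2E1HeckeAlgebraLettersCM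

/-! ## §1 Generic Hilbert-space algebra: commuting self-adjoint idempotents and the letters of `V = {P v = v}` -/

section Hilbert

variable {V : Type*} [NormedAddCommGroup V] [InnerProductSpace ℂ V] [CompleteSpace V]

omit [CompleteSpace V] in
/-- Commuting idempotents compose to an idempotent: `(P₁P₂)(P₁P₂) = P₁P₂`. [folklore] -/
theorem comp_idem_of_commute (P₁ P₂ : V →L[ℂ] V) (h₁ : P₁ ∘L P₁ = P₁) (h₂ : P₂ ∘L P₂ = P₂) (hc : P₁ ∘L P₂ = P₂ ∘L P₁) :
    (P₁ ∘L P₂) ∘L (P₁ ∘L P₂) = P₁ ∘L P₂ := by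
  rw [ContinuousLinearMap.comp_assoc, ← ContinuousLinearMap.comp_assoc P₂ P₁ P₂, ← hc, ContinuousLinearMap.comp_assoc, h₂, ← ContinuousLinearMap.comp_assoc, h₁]

/-- Commuting self-adjoint operators compose to a self-adjoint operator: `(P₁P₂)† = P₂†P₁† = P₂P₁ = P₁P₂`. [folklore] -/
theorem adjoint_comp_of_commute (P₁ P₂ : V →L[ℂ] V) (h₁ : ContinuousLinearMap.adjoint P₁ = P₁) (h₂ : ContinuousLinearMap.adjoint P₂ = P₂) (hc : P₁ ∘L P₂ = P₂ ∘L P₁) :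
    ContinuousLinearMap.adjoint (P₁ ∘L P₂) = P₁ ∘L P₂ := by
  rw [ContinuousLinearMap.adjoint_comp, h₁, h₂, hc]

omit [InnerProductSpace ℂ V] [CompleteSpace V] in
/-- **`hPV`**: an idempotent maps into `V = {v | P v = v}` (`LinearMap.eqLocus P id`). [folklore] -/
theorem mem_eqLocus_of_idem [Module ℂ V] (P : V →L[ℂ] V) (hP : P ∘L P = P) (x : V) : P x ∈ LinearMap.eqLocus (P : V →ₗ[ℂ] V) LinearMap.id := by
  rw [LinearMap.mem_eqLocus, ContinuousLinearMap.coe_coe, LinearMap.id_apply, ← ContinuousLinearMap.comp_apply, hP]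

omit [InnerProductSpace ℂ V] [CompleteSpace V] in
/-- **`hPid`**: `P v = v` on `V = {v | P v = v}`. [folklore] -/
theorem apply_eq_of_mem_eqLocus [Module ℂ V] (P : V →L[ℂ] V) (v : V) (hv : v ∈ LinearMap.eqLocus (P : V →ₗ[ℂ] V) LinearMap.id) : P v = v :=
  LinearMap.mem_eqLocus.1 hv

omit [InnerProductSpace ℂ V] [CompleteSpace V] in
/-- **`hVc`**: `V = {v | P v = v}` is closed. [folklore] -/
theorem isClosed_eqLocus_id [Module ℂ V] (P : V →L[ℂ] V) : IsClosed (LinearMap.eqLocus (P : V →ₗ[ℂ] V) LinearMap.id : Set V) :=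
  isClosed_eq P.continuous continuous_id

/-- **`hPsa`**: a self-adjoint `P` satisfies `⟪P x, y⟫ = ⟪x, P y⟫`. [folklore] -/
theorem inner_left_eq_of_adjoint_eq (P : V →L[ℂ] V) (hP : ContinuousLinearMap.adjoint P = P) (x y : V) : ⟪P x, y⟫_ℂ = ⟪x, P y⟫_ℂ := by
  rw [← ContinuousLinearMap.adjoint_inner_left P y x, hP]

end Hilbert

/-! ## §2 Two-factor generic: `hAW` for pure tensors and the block projector `P = P_χ ∘ R₂ e` -/

section TwoFactor

variable {G G₁ G₂ K V : Type*} [Group G] [TopologicalSpace G]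
  [Group G₁] [TopologicalSpace G₁] [MeasurableSpace G₁] [BorelSpace G₁]
  [Group G₂] [TopologicalSpace G₂] [MeasurableSpace G₂] [BorelSpace G₂]
  [Group K] [TopologicalSpace K] [MeasurableSpace K] [BorelSpace K]
  [NormedAddCommGroup V] [InnerProductSpace ℂ V] [CompleteSpace V]
  (π : ContRepresentation ℂ G V) (hu : π.IsUnitary) (hc : π.IsStronglyContinuous)
  (ι₁ : G₁ →* G) (hι₁ : Continuous ι₁) (ι₂ : G₂ →* G) (hι₂ : Continuous ι₂) (κ : K →* G₁) (hκ : Continuous κ)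
  (η₁ : Measure G₁) [IsFiniteMeasureOnCompacts η₁] (η₂ : Measure G₂) [IsFiniteMeasureOnCompacts η₂]
  (μ : Measure K) [IsFiniteMeasureOnCompacts μ] (χ : C_c(K, ℂ))

omit [MeasurableSpace K] [BorelSpace K] [IsFiniteMeasureOnCompacts μ] in
/-- **`hAW` FOR PURE TENSORS**: `R₁ a ∘L R₂ b` preserves every closed `π`-stable subspace `W` — `W` is a closed subrepresentation of each restriction `π|_{Gᵢ}`, and ★ `integratedOperator_apply_mem`.
[cite: DeitmarEchterhoff2014, §9.2] -/
theorem pureTensor_apply_mem (W : ClosedSubrep π) :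
    ∀ A ∈ {A : V →L[ℂ] V | ∃ (a : C_c(G₁, ℂ)) (b : C_c(G₂, ℂ)),
      A = (π.restrict ι₁).integratedOperator (hu.restrict ι₁) (hc.restrict ι₁ hι₁) η₁ a ∘L (π.restrict ι₂).integratedOperator (hu.restrict ι₂) (hc.restrict ι₂ hι₂) η₂ b},
      ∀ w ∈ W, A w ∈ W := by
  rintro _ ⟨a, b, rfl⟩ w hw
  have h₂ := ContRepresentation.integratedOperator_apply_mem (hu.restrict ι₂) (hc.restrict ι₂ hι₂) η₂ b
    (⟨⟨W.toSubmodule, fun y v hv => W.apply_mem_toSubmodule (ι₂ y) hv⟩, W.isClosed'⟩ : ClosedSubrep (π.restrict ι₂)) (v := w) hw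
  exact ContRepresentation.integratedOperator_apply_mem (hu.restrict ι₁) (hc.restrict ι₁ hι₁) η₁ a
    (⟨⟨W.toSubmodule, fun x v hv => W.apply_mem_toSubmodule (ι₁ x) hv⟩, W.isClosed'⟩ : ClosedSubrep (π.restrict ι₁)) h₂

omit [MeasurableSpace G₁] [BorelSpace G₁] [IsFiniteMeasureOnCompacts η₁] in
/-- **`hPW` FOR THE BLOCK PROJECTOR**: `P_χ ∘L R₂ e` preserves every closed `π`-stable `W` (both factors are integrated operators of restrictions of `π`). [cite: DeitmarEchterhoff2014, §9.2] -/
theorem blockProjector_apply_mem (W : ClosedSubrep π) (e : C_c(G₂, ℂ)) (w : V) (hw : w ∈ W) :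
    ((π.restrict (ι₁.comp κ)).integratedOperator (hu.restrict (ι₁.comp κ)) (hc.restrict (ι₁.comp κ) (hι₁.comp hκ)) μ χ ∘L
        (π.restrict ι₂).integratedOperator (hu.restrict ι₂) (hc.restrict ι₂ hι₂) η₂ e) w ∈ W := by
  have h₂ := ContRepresentation.integratedOperator_apply_mem (hu.restrict ι₂) (hc.restrict ι₂ hι₂) η₂ e
    (⟨⟨W.toSubmodule, fun y v hv => W.apply_mem_toSubmodule (ι₂ y) hv⟩, W.isClosed'⟩ : ClosedSubrep (π.restrict ι₂)) (v := w) hw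
  exact ContRepresentation.integratedOperator_apply_mem (hu.restrict (ι₁.comp κ)) (hc.restrict (ι₁.comp κ) (hι₁.comp hκ)) μ χ
    (⟨⟨W.toSubmodule, fun k v hv => W.apply_mem_toSubmodule (ι₁ (κ k)) hv⟩, W.isClosed'⟩ : ClosedSubrep (π.restrict (ι₁.comp κ))) h₂

omit [MeasurableSpace G₁] [BorelSpace G₁] [IsFiniteMeasureOnCompacts η₁] in
/-- **THE BLOCK PROJECTOR IS IDEMPOTENT**: `P_χ` idempotent (★ `kType_comp_self`), `R₂ e` idempotent (★ `level_comp_self`), and they commute (★ `kType_comm_integratedOperator`).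
[cite: Knapp1986, VIII §3] [cite: BorelJacquet1979, §4.1] -/
theorem blockProjector_idem [IsProbabilityMeasure μ] [MeasurableMul K] [μ.IsMulLeftInvariant] [MeasurableMul G₂] [η₂.IsMulLeftInvariant]
    (hcomm : ∀ (x : G₁) (y : G₂), ι₁ x * ι₂ y = ι₂ y * ι₁ x) (hχmul : ∀ k l, χ (k * l) = χ k * χ l) (hχone : χ 1 = 1)
    (K' : Subgroup G₂) (e : C_c(G₂, ℂ)) (he0 : ∀ x, x ∉ K' → e x = 0) (he1 : ∫ x, e x ∂η₂ = 1) (heK : ∀ k ∈ K', ∀ x, e (k * x) = e x) :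
    ((π.restrict (ι₁.comp κ)).integratedOperator (hu.restrict (ι₁.comp κ)) (hc.restrict (ι₁.comp κ) (hι₁.comp hκ)) μ χ ∘L
        (π.restrict ι₂).integratedOperator (hu.restrict ι₂) (hc.restrict ι₂ hι₂) η₂ e) ∘L
      ((π.restrict (ι₁.comp κ)).integratedOperator (hu.restrict (ι₁.comp κ)) (hc.restrict (ι₁.comp κ) (hι₁.comp hκ)) μ χ ∘L
        (π.restrict ι₂).integratedOperator (hu.restrict ι₂) (hc.restrict ι₂ hι₂) η₂ e) =
      (π.restrict (ι₁.comp κ)).integratedOperator (hu.restrict (ι₁.comp κ)) (hc.restrict (ι₁.comp κ) (hι₁.comp hκ)) μ χ ∘L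
        (π.restrict ι₂).integratedOperator (hu.restrict ι₂) (hc.restrict ι₂ hι₂) η₂ e :=
  comp_idem_of_commute _ _ (K2E1KTypeProjectorPureTensorU.kType_comp_self π hu hc ι₁ hι₁ κ hκ μ χ hχmul hχone)
    (K2E1KTypeProjectorPureTensorU.level_comp_self (π.restrict ι₂) (hu.restrict ι₂) (hc.restrict ι₂ hι₂) η₂ K' e he0 he1 heK)
    (kType_comm_integratedOperator π hu hc ι₁ hι₁ ι₂ κ hκ μ χ hι₂ η₂ hcomm e)

omit [MeasurableSpace G₁] [BorelSpace G₁] [IsFiniteMeasureOnCompacts η₁] in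
/-- **THE BLOCK PROJECTOR IS SELF-ADJOINT**: `P_χ† = P_χ` (★ `adjoint_kType`), `(R₂ e)† = R₂ e` (★ `adjoint_level`), and they commute. [cite: Knapp1986, VIII §3] [cite: DeitmarEchterhoff2014, Prop. 6.2.1] -/
theorem blockProjector_adjoint [MeasurableInv K] [μ.IsInvInvariant] [MeasurableInv G₂] [η₂.IsInvInvariant]
    (hcomm : ∀ (x : G₁) (y : G₂), ι₁ x * ι₂ y = ι₂ y * ι₁ x) (hχinv : ∀ k, conj (χ k⁻¹) = χ k) (e : C_c(G₂, ℂ)) (hestar : ∀ x, mulStar (⇑e) x = e x) :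
    ContinuousLinearMap.adjoint ((π.restrict (ι₁.comp κ)).integratedOperator (hu.restrict (ι₁.comp κ)) (hc.restrict (ι₁.comp κ) (hι₁.comp hκ)) μ χ ∘L
        (π.restrict ι₂).integratedOperator (hu.restrict ι₂) (hc.restrict ι₂ hι₂) η₂ e) =
      (π.restrict (ι₁.comp κ)).integratedOperator (hu.restrict (ι₁.comp κ)) (hc.restrict (ι₁.comp κ) (hι₁.comp hκ)) μ χ ∘L
        (π.restrict ι₂).integratedOperator (hu.restrict ι₂) (hc.restrict ι₂ hι₂) η₂ e :=
  adjoint_comp_of_commute _ _ (K2E1KTypeProjectorPureTensorU.adjoint_kType π hu hc ι₁ hι₁ κ hκ μ χ hχinv)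
    (K2E1KTypeProjectorPureTensorU.adjoint_level (π.restrict ι₂) (hu.restrict ι₂) (hc.restrict ι₂ hι₂) η₂ e hestar)
    (kType_comm_integratedOperator π hu hc ι₁ hι₁ ι₂ κ hκ μ χ hι₂ η₂ hcomm e)

end TwoFactor

/-! ## §3 The E1 prints at ★ `cmDatum L N H` -/

section CM

variable {L : Type} [Field L] [NumberField L] [IsCMField L] {N : ℕ} {H : Matrix (Fin N) (Fin N) L}
  {K V : Type*} [Group K] [TopologicalSpace K] [MeasurableSpace K] [BorelSpace K]
  [NormedAddCommGroup V] [InnerProductSpace ℂ V] [CompleteSpace V]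
  (π : ContRepresentation ℂ (cmDatum L N H).Adelic V) (hu : π.IsUnitary) (hc : π.IsStronglyContinuous)
  [MeasurableSpace (UnitaryGroup.arch (↥(maximalRealSubfield L)) L (IsCMField.complexConj L) N H)] [BorelSpace (UnitaryGroup.arch (↥(maximalRealSubfield L)) L (IsCMField.complexConj L) N H)]
  [MeasurableSpace (finAdelic (↥(maximalRealSubfield L)) L (IsCMField.complexConj L) N H)] [BorelSpace (finAdelic (↥(maximalRealSubfield L)) L (IsCMField.complexConj L) N H)]
  (νinf : Measure (UnitaryGroup.arch (↥(maximalRealSubfield L)) L (IsCMField.complexConj L) N H)) [IsFiniteMeasureOnCompacts νinf]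
  (νf : Measure (finAdelic (↥(maximalRealSubfield L)) L (IsCMField.complexConj L) N H)) [IsFiniteMeasureOnCompacts νf]

omit [MeasurableSpace K] [BorelSpace K] in
/-- **`hnd` AT `U(H)(𝔸_{L⁺})`, INSTANCE EDITION**: for measures `ν_∞`, `ν_f` positive on opens (Haar measures), the pure tensors `{π_∞(a) ∘L π_f(b)}` are non-degenerate — Dirac sequences
exist on the locally compact, Hausdorff, second countable groups `U(H)(L⁺ ⊗ ℝ)` and `U(H)(𝔸_{L⁺,f})` (★ `exists_isDiracSequence`). ★ p860349's `hnd` verbatim. [cite: DeitmarEchterhoff2014, Lemma 6.2.2] -/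
theorem cm_pureTensor_nondegenerate [νinf.IsOpenPosMeasure] [νf.IsOpenPosMeasure] :
    ∀ v : V, (∀ A ∈ {A : V →L[ℂ] V | ∃ (a : C_c(UnitaryGroup.arch (↥(maximalRealSubfield L)) L (IsCMField.complexConj L) N H, ℂ))
        (b : C_c(finAdelic (↥(maximalRealSubfield L)) L (IsCMField.complexConj L) N H, ℂ)),
      A = (π.restrict (archToAdelic (↥(maximalRealSubfield L)) L (IsCMField.complexConj L) N H)).integratedOperator (hu.restrict _)
            (hc.restrict _ (continuous_archToAdelic (↥(maximalRealSubfield L)) L (IsCMField.complexConj L) N H)) νinf a ∘L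
          (π.restrict (finAdelicToAdelic (↥(maximalRealSubfield L)) L (IsCMField.complexConj L) N H)).integratedOperator (hu.restrict _)
            (hc.restrict _ (continuous_finAdelicToAdelic (↥(maximalRealSubfield L)) L (IsCMField.complexConj L) N H)) νf b}, A v = 0) → v = 0 := by
  haveI := t2Space_finAdelic (↥(maximalRealSubfield L)) L (IsCMField.complexConj L) N H
  haveI := locallyCompactSpace_finAdelic (↥(maximalRealSubfield L)) L (IsCMField.complexConj L) N H
  haveI := secondCountableTopology_finAdelic (↥(maximalRealSubfield L)) L (IsCMField.complexConj L) N H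
  obtain ⟨φ, hφ, -⟩ := exists_isDiracSequence νinf
  obtain ⟨ψ, hψ, -⟩ := exists_isDiracSequence νf
  exact fun v hv => eq_zero_of_forall_pureTensor_apply_eq_zero π hu hc _ (continuous_archToAdelic (↥(maximalRealSubfield L)) L (IsCMField.complexConj L) N H)
    _ (continuous_finAdelicToAdelic (↥(maximalRealSubfield L)) L (IsCMField.complexConj L) N H) νinf νf hφ hψ v hv

omit [MeasurableSpace K] [BorelSpace K] in
/-- **`hAW` AT `U(H)(𝔸_{L⁺})`**: every pure tensor `π_∞(a) ∘L π_f(b)` preserves every closed `π`-stable `W` (E1: an irreducible summand of `L²`, or `(L²_cusp)ᗮ`). ★ p860349's `hAW` verbatim.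
[cite: DeitmarEchterhoff2014, §9.2] -/
theorem cm_pureTensor_apply_mem (W : ClosedSubrep π) :
    ∀ A ∈ {A : V →L[ℂ] V | ∃ (a : C_c(UnitaryGroup.arch (↥(maximalRealSubfield L)) L (IsCMField.complexConj L) N H, ℂ))
        (b : C_c(finAdelic (↥(maximalRealSubfield L)) L (IsCMField.complexConj L) N H, ℂ)),
      A = (π.restrict (archToAdelic (↥(maximalRealSubfield L)) L (IsCMField.complexConj L) N H)).integratedOperator (hu.restrict _)
            (hc.restrict _ (continuous_archToAdelic (↥(maximalRealSubfield L)) L (IsCMField.complexConj L) N H)) νinf a ∘L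
          (π.restrict (finAdelicToAdelic (↥(maximalRealSubfield L)) L (IsCMField.complexConj L) N H)).integratedOperator (hu.restrict _)
            (hc.restrict _ (continuous_finAdelicToAdelic (↥(maximalRealSubfield L)) L (IsCMField.complexConj L) N H)) νf b},
      ∀ w ∈ W, A w ∈ W :=
  pureTensor_apply_mem π hu hc _ (continuous_archToAdelic (↥(maximalRealSubfield L)) L (IsCMField.complexConj L) N H)
    _ (continuous_finAdelicToAdelic (↥(maximalRealSubfield L)) L (IsCMField.complexConj L) N H) νinf νf W

variable (κ : K →* UnitaryGroup.arch (↥(maximalRealSubfield L)) L (IsCMField.complexConj L) N H) (hκ : Continuous κ)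
  (μ : Measure K) [IsFiniteMeasureOnCompacts μ] (χ : C_c(K, ℂ)) (e : C_c(finAdelic (↥(maximalRealSubfield L)) L (IsCMField.complexConj L) N H, ℂ))

omit [MeasurableSpace (UnitaryGroup.arch (↥(maximalRealSubfield L)) L (IsCMField.complexConj L) N H)] [BorelSpace (UnitaryGroup.arch (↥(maximalRealSubfield L)) L (IsCMField.complexConj L) N H)]
  [IsFiniteMeasureOnCompacts νinf] in
/-- **`hPV` AT `U(H)(𝔸_{L⁺})`**: the block projector `P = P_χ ∘L R_f(e)` (`P_χ = ∫_K χ(k) π(κ k, 1) dμ` for a compact `K →* U(H)(L⁺ ⊗ ℝ)`, `e = e_{K′}` a level idempotent kernel) maps into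
`V = {v | P v = v}` — it is idempotent (§2 `blockProjector_idem`). [cite: Knapp1986, VIII §3] [cite: BorelJacquet1979, §4.1] -/
theorem cm_blockProjector_hPV [IsProbabilityMeasure μ] [MeasurableMul K] [μ.IsMulLeftInvariant] [νf.IsMulLeftInvariant]
    (hχmul : ∀ k l, χ (k * l) = χ k * χ l) (hχone : χ 1 = 1)
    (K' : Subgroup (finAdelic (↥(maximalRealSubfield L)) L (IsCMField.complexConj L) N H)) (he0 : ∀ x, x ∉ K' → e x = 0) (he1 : ∫ x, e x ∂νf = 1)
    (heK : ∀ k ∈ K', ∀ x, e (k * x) = e x) (x : V) :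
    ((π.restrict ((archToAdelic (↥(maximalRealSubfield L)) L (IsCMField.complexConj L) N H).comp κ)).integratedOperator (hu.restrict _)
          (hc.restrict _ ((continuous_archToAdelic (↥(maximalRealSubfield L)) L (IsCMField.complexConj L) N H).comp hκ)) μ χ ∘L
        (π.restrict (finAdelicToAdelic (↥(maximalRealSubfield L)) L (IsCMField.complexConj L) N H)).integratedOperator (hu.restrict _)
          (hc.restrict _ (continuous_finAdelicToAdelic (↥(maximalRealSubfield L)) L (IsCMField.complexConj L) N H)) νf e) x ∈
      LinearMap.eqLocus (((π.restrict ((archToAdelic (↥(maximalRealSubfield L)) L (IsCMField.complexConj L) N H).comp κ)).integratedOperator (hu.restrict _)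
          (hc.restrict _ ((continuous_archToAdelic (↥(maximalRealSubfield L)) L (IsCMField.complexConj L) N H).comp hκ)) μ χ ∘L
        (π.restrict (finAdelicToAdelic (↥(maximalRealSubfield L)) L (IsCMField.complexConj L) N H)).integratedOperator (hu.restrict _)
          (hc.restrict _ (continuous_finAdelicToAdelic (↥(maximalRealSubfield L)) L (IsCMField.complexConj L) N H)) νf e : V →L[ℂ] V) : V →ₗ[ℂ] V) LinearMap.id :=
  mem_eqLocus_of_idem _ (blockProjector_idem π hu hc _ (continuous_archToAdelic (↥(maximalRealSubfield L)) L (IsCMField.complexConj L) N H)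
    _ (continuous_finAdelicToAdelic (↥(maximalRealSubfield L)) L (IsCMField.complexConj L) N H) κ hκ νf μ χ
    (K2E1PureTensorHeckeAlgebraU.cm_hcomm) hχmul hχone K' e he0 he1 heK) x

omit [MeasurableSpace (UnitaryGroup.arch (↥(maximalRealSubfield L)) L (IsCMField.complexConj L) N H)] [BorelSpace (UnitaryGroup.arch (↥(maximalRealSubfield L)) L (IsCMField.complexConj L) N H)]
  [IsFiniteMeasureOnCompacts νinf] in
/-- **`hPsa` AT `U(H)(𝔸_{L⁺})`**: the block projector is self-adjoint, `⟪P x, y⟫ = ⟪x, P y⟫` (§2 `blockProjector_adjoint`: `χ* = χ`, `e* = e`, `μ`, `ν_f` inversion-invariant).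
[cite: Knapp1986, VIII §3] [cite: DeitmarEchterhoff2014, Prop. 6.2.1] -/
theorem cm_blockProjector_hPsa [MeasurableInv K] [μ.IsInvInvariant] [νf.IsInvInvariant] (hχinv : ∀ k, conj (χ k⁻¹) = χ k) (hestar : ∀ x, mulStar (⇑e) x = e x) (x y : V) :
    ⟪((π.restrict ((archToAdelic (↥(maximalRealSubfield L)) L (IsCMField.complexConj L) N H).comp κ)).integratedOperator (hu.restrict _)
          (hc.restrict _ ((continuous_archToAdelic (↥(maximalRealSubfield L)) L (IsCMField.complexConj L) N H).comp hκ)) μ χ ∘L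
        (π.restrict (finAdelicToAdelic (↥(maximalRealSubfield L)) L (IsCMField.complexConj L) N H)).integratedOperator (hu.restrict _)
          (hc.restrict _ (continuous_finAdelicToAdelic (↥(maximalRealSubfield L)) L (IsCMField.complexConj L) N H)) νf e) x, y⟫_ℂ =
      ⟪x, ((π.restrict ((archToAdelic (↥(maximalRealSubfield L)) L (IsCMField.complexConj L) N H).comp κ)).integratedOperator (hu.restrict _)
          (hc.restrict _ ((continuous_archToAdelic (↥(maximalRealSubfield L)) L (IsCMField.complexConj L) N H).comp hκ)) μ χ ∘L
        (π.restrict (finAdelicToAdelic (↥(maximalRealSubfield L)) L (IsCMField.complexConj L) N H)).integratedOperator (hu.restrict _)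
          (hc.restrict _ (continuous_finAdelicToAdelic (↥(maximalRealSubfield L)) L (IsCMField.complexConj L) N H)) νf e) y⟫_ℂ :=
  inner_left_eq_of_adjoint_eq _ (blockProjector_adjoint π hu hc _ (continuous_archToAdelic (↥(maximalRealSubfield L)) L (IsCMField.complexConj L) N H)
    _ (continuous_finAdelicToAdelic (↥(maximalRealSubfield L)) L (IsCMField.complexConj L) N H) κ hκ νf μ χ
    (K2E1PureTensorHeckeAlgebraU.cm_hcomm) hχinv e hestar) x y

omit [MeasurableSpace (UnitaryGroup.arch (↥(maximalRealSubfield L)) L (IsCMField.complexConj L) N H)] [BorelSpace (UnitaryGroup.arch (↥(maximalRealSubfield L)) L (IsCMField.complexConj L) N H)]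
  [IsFiniteMeasureOnCompacts νinf] in
/-- **`hPW` AT `U(H)(𝔸_{L⁺})`**: the block projector preserves every closed `π`-stable `W` (§2 `blockProjector_apply_mem`). [cite: DeitmarEchterhoff2014, §9.2] -/
theorem cm_blockProjector_hPW (W : ClosedSubrep π) :
    ∀ w ∈ W, ((π.restrict ((archToAdelic (↥(maximalRealSubfield L)) L (IsCMField.complexConj L) N H).comp κ)).integratedOperator (hu.restrict _)
          (hc.restrict _ ((continuous_archToAdelic (↥(maximalRealSubfield L)) L (IsCMField.complexConj L) N H).comp hκ)) μ χ ∘L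
        (π.restrict (finAdelicToAdelic (↥(maximalRealSubfield L)) L (IsCMField.complexConj L) N H)).integratedOperator (hu.restrict _)
          (hc.restrict _ (continuous_finAdelicToAdelic (↥(maximalRealSubfield L)) L (IsCMField.complexConj L) N H)) νf e) w ∈ W :=
  fun w hw => blockProjector_apply_mem π hu hc _ (continuous_archToAdelic (↥(maximalRealSubfield L)) L (IsCMField.complexConj L) N H)
    _ (continuous_finAdelicToAdelic (↥(maximalRealSubfield L)) L (IsCMField.complexConj L) N H) κ hκ νf μ χ W e w hw

end CM

end Summit.HodgeConjecture.HodgeConjecture.Cruxes.H413.K2E1HeckeAlgebraLettersCM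

end
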